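import Literature.Analysis.FunctionSpaces.SpinorWightmanTwoPoint
import Literature.MathematicalPhysics.QuantumLattice.TubeCovarianceTransport
import HarnessLib

/-!
# Spinor Wightman fields: `SL(2, ℂ)` covariance of the `n`-point distributions and of their
holomorphic extensions (the transformation law (3-42)–(3-44) of Streater–Wightman Thm. 3-5)

Topic `Literature/Analysis/FunctionSpaces`, companion of `SpinorWightmanDistributions` on the way to
the PCT theorem `Literature.Analysis.FunctionSpaces.pct_theorem` (Streater–Wightman (1964), §4-3,
Thm. 4-7). For a spinor theory `IsSpinorWightmanQFT W`, a species sequence `k : Fin n → κ` and a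
multi-index `α : (j : Fin n) → Fin (mult (k j))`:

* `IsSpinorWightmanQFT.spinRep_cmonomialVec` — **W2' for monomial vectors**:
  `U(0, A) φ_{α₁}(f₁) ⋯ φ_{αₙ}(fₙ) Ω = ∑_β ∏ⱼ S_{kⱼ}(A⁻¹)_{αⱼβⱼ} φ_{β₁}(Λf₁) ⋯ φ_{βₙ}(Λfₙ) Ω`
  (`(Λf)(x) = f(Λ(A)⁻¹ x)`, `poincareTest (gSL A)` of `SpinorWightmanTwoPoint`), by induction on the monomial from the axiom
  `IsSpinorWightmanQFT.covariant`;
* `IsSpinorWightmanQFT.wightmanFn_gSL` — **the transformation law of the Wightman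
  functions** (S–W (3-42)): `𝒲_α(Λf) = ∑_β ∏ⱼ S_{kⱼ}(A)_{αⱼβⱼ} 𝒲_β(f)` (unitarity of `U(0, A)` and
  invariance of `Ω`);
* `IsSpinorWightmanQFT.wDist hW k α` — the `n`-point **Wightman distribution** of the components
  `(kⱼ, αⱼ)` (the `vectorDistribution` of `Ω`), its values on tensor products
  (`wDist_apply_of_isTensorOf`), its translation invariance and its transformation law under
  `(0, Λ(A))` as identities of distributions (`wDist_comp_poincareTestMulti_inl/inr`);
* `IsSpinorWightmanQFT.wRelFn hW k` — **the holomorphic Wightman function on the relative tube**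
  `𝒯ʳₙ`, with values in the multi-index space: holomorphic, invariant under all common complex
  translations, componentwise boundary value `wDist`, and **covariant**:
  `𝒲(Λ(A) z)_α = ∑_β ∏ⱼ S_{kⱼ}(A)_{αⱼβⱼ} 𝒲(z)_β` on `𝒯ʳₙ` (S–W Thm. 3-5 with (3-44), through
  `apply_lorentz_eq_sum_of_bv` of `TubeCovarianceTransport`).

## References

* R. F. Streater, A. S. Wightman, *PCT, Spin and Statistics, and All That* (1964; Princeton 2000),
  §3-1 eq. (3-4), §3-3 eqs. (3-42)–(3-44), Thm. 3-5. [StreaterWightman1964]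
-/

noncomputable section

open Filter MeasureTheory Set ComplexConjugate Complex
open _root_.Topology
open scoped InnerProductSpace SchwartzMap MatrixGroups
open Literature.MathematicalPhysics Literature.MathematicalPhysics.QuantumLattice

namespace Literature.Analysis.FunctionSpaces

variable {κ : Type*}

namespace SpinorWightmanData

variable (W : SpinorWightmanData κ)

/-- The multi-indices of a species sequence `k`: `α : (j : Fin n) → Fin (mult (k j))`. [folklore] -/
abbrev MIdx {n : ℕ} (k : Fin n → κ) : Type := (j : Fin n) → Fin (W.mult (k j))

end SpinorWightmanData

namespace IsSpinorWightmanQFT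

open SpinorWightmanData

variable {W : SpinorWightmanData κ}

/-! ### The pure Lorentz elements `(0, Λ(A))` acting on test functions -/

/-- `(0, Λ(AB)) • f = (0, Λ(A)) • ((0, Λ(B)) • f)`. [folklore] -/
theorem poincareTest_gSL_mul (A B : SL(2, ℂ)) :
    poincareTest (gSL (A * B)) = (poincareTest (gSL A)).comp (poincareTest (gSL B)) := by
  show poincareTest (SemidirectProduct.inr (spinCoverHom (A * B))) = _
  rw [map_mul, map_mul, poincareTest_mul]

/-- `(0, Λ(1)) • f = f`. [folklore] -/
theorem poincareTest_gSL_one (f : 𝓢(SpaceTime 3, ℂ)) : poincareTest (gSL 1) f = f := by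
  ext x
  show poincareTest (SemidirectProduct.inr (spinCoverHom 1)) f x = f x
  rw [map_one, map_one, poincareTest_apply]
  simp

/-- `(0, Λ(A⁻¹)) • ((0, Λ(A)) • f) = f`. [folklore] -/
theorem poincareTest_gSL_inv_apply (A : SL(2, ℂ)) (f : 𝓢(SpaceTime 3, ℂ)) :
    poincareTest (gSL A⁻¹) (poincareTest (gSL A) f) = f := by
  rw [← ContinuousLinearMap.comp_apply, ← poincareTest_gSL_mul, inv_mul_cancel, poincareTest_gSL_one]

/-! ### W2' for monomial vectors -/

/-- **W2' for monomial vectors**: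
`U(A) φ_{α₁}(f₁) ⋯ φ_{αₙ}(fₙ) Ω = ∑_β ∏ⱼ S_{kⱼ}(A⁻¹)_{αⱼβⱼ} φ_{β₁}(Λf₁) ⋯ φ_{βₙ}(Λfₙ) Ω`.
[cite: StreaterWightman1964, §3-1 eq. (3-4)] -/
theorem spinRep_cmonomialVec (hW : IsSpinorWightmanQFT W) (A : SL(2, ℂ)) :
    ∀ {n : ℕ} (k : Fin n → κ) (α : W.MIdx k) (f : Fin n → 𝓢(SpaceTime 3, ℂ)),
      (W.spinRep A : W.H →L[ℂ] W.H) (W.cmonomialVec (List.ofFn fun j => ((⟨k j, α j⟩ : W.Idx), f j)) : W.H) =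
        ∑ β : W.MIdx k, (∏ j, W.S (k j) A⁻¹ (α j) (β j)) •
          (W.cmonomialVec (List.ofFn fun j => ((⟨k j, β j⟩ : W.Idx), poincareTest (gSL A) (f j))) : W.H) := by
  intro n
  induction n with
  | zero =>
    intro k α f
    simp [List.ofFn_zero, hW.spinRep_vacuum A]
  | succ m ih =>
    intro k α f
    -- split off the first letter
    rw [List.ofFn_succ, cmonomialVec_cons]
    dsimp only
    rw [cfield_mk, hW.spinRep_field A (k 0) (α 0) (f 0)]
    -- the tail by induction
    have htail := ih (fun j => k j.succ) (fun j => α j.succ) (fun j => f j.succ)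
    have htail' : (⟨(W.spinRep A : W.H →L[ℂ] W.H) (W.cmonomialVec (List.ofFn fun j =>
        ((⟨k j.succ, α j.succ⟩ : W.Idx), f j.succ)) : W.H), hW.spinRep_dom A _ (W.cmonomialVec _).2⟩ : W.dom) =
        ∑ β : W.MIdx (fun j => k j.succ), (∏ j, W.S (k j.succ) A⁻¹ (α j.succ) (β j)) •
          W.cmonomialVec (List.ofFn fun j => ((⟨k j.succ, β j⟩ : W.Idx), poincareTest (gSL A) (f j.succ))) := by
      apply Subtype.ext
      simp only [Submodule.coe_sum, Submodule.coe_smul]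
      exact htail
    simp_rw [htail', map_sum, map_smul, Submodule.coe_sum, Submodule.coe_smul, Finset.smul_sum, smul_smul]
    -- reassemble the double sum over `(β₀, β')` as a sum over `β = Fin.cons β₀ β'`
    symm
    rw [← (Fin.consEquiv fun j => Fin (W.mult (k j))).sum_comp, Fintype.sum_prod_type]
    refine Finset.sum_congr rfl fun β₀ _ => Finset.sum_congr rfl fun β' _ => ?_
    simp only [Fin.consEquiv_apply]
    rw [Fin.prod_univ_succ]
    simp only [Fin.cons_zero, Fin.cons_succ]
    congr 1
    rw [List.ofFn_succ, cmonomialVec_cons]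
    simp only [Fin.cons_zero, Fin.cons_succ, cfield_mk]

/-! ### The transformation law of the Wightman functions -/

/-- The Wightman function in terms of monomial vectors of components. [folklore] -/
theorem wightmanFn_eq_inner {n : ℕ} (k : Fin n → κ) (α : W.MIdx k) (f : Fin n → 𝓢(SpaceTime 3, ℂ)) :
    W.wightmanFn n k α f = ⟪W.vacuum, (W.cmonomialVec (List.ofFn fun j => ((⟨k j, α j⟩ : W.Idx), f j)) : W.H)⟫_ℂ :=
  (W.cWightmanFn_eq_wightmanFn n (fun j => (⟨k j, α j⟩ : W.Idx)) f).symm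

/-- **W2' for Wightman functions, first form**: `𝒲_α(f) = ∑_β ∏ⱼ S_{kⱼ}(A⁻¹)_{αⱼβⱼ} 𝒲_β(Λf)`.
[cite: StreaterWightman1964, §3-3 eq. (3-42)] -/
theorem wightmanFn_eq_sum_gSL (hW : IsSpinorWightmanQFT W) (A : SL(2, ℂ)) {n : ℕ} (k : Fin n → κ)
    (α : W.MIdx k) (f : Fin n → 𝓢(SpaceTime 3, ℂ)) :
    W.wightmanFn n k α f =
      ∑ β : W.MIdx k, (∏ j, W.S (k j) A⁻¹ (α j) (β j)) * W.wightmanFn n k β (fun j => poincareTest (gSL A) (f j)) := by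
  rw [wightmanFn_eq_inner, ← Unitary.inner_map_map (W.spinRep A), hW.spinRep_vacuum A,
    hW.spinRep_cmonomialVec A k α f, inner_sum]
  refine Finset.sum_congr rfl fun β _ => ?_
  rw [inner_smul_right, wightmanFn_eq_inner]

/-- **The transformation law of the Wightman functions** (Streater–Wightman (1964), eq. (3-42)):
`𝒲_α(Λf) = ∑_β ∏ⱼ S_{kⱼ}(A)_{αⱼβⱼ} 𝒲_β(f)`, `(Λf)(x) = f(Λ(A)⁻¹x)`. [cite: StreaterWightman1964, §3-3 eq. (3-42)] -/
theorem wightmanFn_gSL (hW : IsSpinorWightmanQFT W) (A : SL(2, ℂ)) {n : ℕ} (k : Fin n → κ)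
    (α : W.MIdx k) (f : Fin n → 𝓢(SpaceTime 3, ℂ)) :
    W.wightmanFn n k α (fun j => poincareTest (gSL A) (f j)) =
      ∑ β : W.MIdx k, (∏ j, W.S (k j) A (α j) (β j)) * W.wightmanFn n k β f := by
  have h := hW.wightmanFn_eq_sum_gSL A⁻¹ k α (fun j => poincareTest (gSL A) (f j))
  simp only [inv_inv, poincareTest_gSL_inv_apply] at h
  exact h

/-! ### The `n`-point distributions of a species sequence -/

/-- The `n`-point **Wightman distribution of the components `(kⱼ, αⱼ)`**,
`𝒲_α = ⟪Ω, φ_{k₁α₁}(x₁) ⋯ φ_{kₙαₙ}(xₙ) Ω⟫ ∈ 𝒮'((ℝ⁴)ⁿ)` (the vector distribution of `Ω`;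
Streater–Wightman (1964), §3-3, eq. (3-19) and the nuclear theorem). [cite: StreaterWightman1964, §3-3 eq. (3-19)] -/
def wDist (hW : IsSpinorWightmanQFT W) {n : ℕ} (k : Fin n → κ) (α : W.MIdx k) :
    𝓢((Fin n → SpaceTime 3), ℂ) →L[ℂ] ℂ :=
  hW.vectorDistribution W.vacuum n fun j => (⟨k j, α j⟩ : W.Idx)

/-- On tensor products the distribution is the Wightman function. [cite: StreaterWightman1964, §3-3 eq. (3-19)] -/
theorem wDist_apply_of_isTensorOf (hW : IsSpinorWightmanQFT W) {n : ℕ} (k : Fin n → κ) (α : W.MIdx k)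
    {G : 𝓢((Fin n → SpaceTime 3), ℂ)} {g : Fin n → 𝓢(SpaceTime 3, ℂ)} (hG : IsTensorOf G g) :
    hW.wDist k α G = W.wightmanFn n k α g := by
  rw [wDist, (hW.isSpinorVectorDistributionOf_vectorDistribution W.vacuum n _).apply_eq_cWightmanFn hG,
    W.cWightmanFn_eq_wightmanFn]

/-- **The transformation law as an identity of distributions**:
`𝒲_α ∘ (0, Λ(A)) = ∑_β ∏ⱼ S_{kⱼ}(A)_{αⱼβⱼ} 𝒲_β` (`((0,Λ) • G)(x) = G(Λ⁻¹x)`).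
[cite: StreaterWightman1964, §3-3 eq. (3-42)] -/
theorem wDist_comp_poincareTestMulti_inr (hW : IsSpinorWightmanQFT W) {n : ℕ} (k : Fin n → κ) (α : W.MIdx k)
    (A : SL(2, ℂ)) :
    (hW.wDist k α).comp (poincareTestMulti n (SemidirectProduct.inr (spinCoverHom A))) =
      ∑ β : W.MIdx k, (∏ j, W.S (k j) A (α j) (β j)) • hW.wDist k β := by
  refine SchwingerFamily.ext_of_denseSpan denseSpan_tensorProducts_holds fun g G hG => ?_
  rw [ContinuousLinearMap.comp_apply, hW.wDist_apply_of_isTensorOf k α (hG.poincareTestMulti _)]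
  change W.wightmanFn n k α (fun j => poincareTest (gSL A) (ofRealTest (g j))) = _
  rw [hW.wightmanFn_gSL A k α, sum_apply]
  refine Finset.sum_congr rfl fun β _ => ?_
  rw [smul_apply, hW.wDist_apply_of_isTensorOf k β hG, smul_eq_mul]

/-- **Translation invariance of the Wightman functions**: `𝒲_α(f(· − a)) = 𝒲_α(f)` (W2' at `A = 1`
and `U(a) Ω = Ω`). [cite: StreaterWightman1964, §3-3 eq. (3-21)] -/
theorem wightmanFn_translate (hW : IsSpinorWightmanQFT W) (a : SpaceTime 3) {n : ℕ} (k : Fin n → κ)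
    (α : W.MIdx k) (f : Fin n → 𝓢(SpaceTime 3, ℂ)) :
    W.wightmanFn n k α (fun j => poincareTest (SemidirectProduct.inl (Multiplicative.ofAdd a) : PoincareGroup 3) (f j)) =
      W.wightmanFn n k α f := by
  have hΩ : W.transl (Multiplicative.ofAdd a) W.vacuum = W.vacuum := by
    have h := hW.U_vacuum a 1
    rwa [W.U_one_right] at h
  have hU := ContinuousLinearMap.inner_map_map_of_mem_unitary (W.transl.apply_mem_unitary (Multiplicative.ofAdd a))
    W.vacuum (W.cmonomialVec (List.ofFn fun j => ((⟨k j, α j⟩ : W.Idx), f j)) : W.H)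
  rw [hΩ, hW.transl_cmonomialVec a, List.map_ofFn] at hU
  rw [wightmanFn_eq_inner, wightmanFn_eq_inner]
  exact hU

/-- **Translation invariance as an identity of distributions**: `𝒲_α ∘ (a, 1) = 𝒲_α`.
[cite: StreaterWightman1964, §3-3 eq. (3-21)] -/
theorem wDist_comp_poincareTestMulti_inl (hW : IsSpinorWightmanQFT W) {n : ℕ} (k : Fin n → κ) (α : W.MIdx k)
    (a : SpaceTime 3) :
    (hW.wDist k α).comp (poincareTestMulti n (SemidirectProduct.inl (Multiplicative.ofAdd a))) = hW.wDist k α := by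
  refine SchwingerFamily.ext_of_denseSpan denseSpan_tensorProducts_holds fun g G hG => ?_
  rw [ContinuousLinearMap.comp_apply, hW.wDist_apply_of_isTensorOf k α (hG.poincareTestMulti _),
    hW.wightmanFn_translate a k α, hW.wDist_apply_of_isTensorOf k α hG]

/-! ### The holomorphic Wightman function of a species sequence on the relative tube -/

/-- The chosen **holomorphic extension of `𝒲_α` to the forward tube** (S–W Thm. 3-5 through the
spectral condition, `IsSpinorWightmanQFT.exists_vectorTubeFunction`). [cite: StreaterWightman1964, Thm 3-5] -/
def wTubeFn (hW : IsSpinorWightmanQFT W) {n : ℕ} (k : Fin n → κ) (α : W.MIdx k) :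
    (Fin n → Fin (3 + 1) → ℂ) → ℂ :=
  (hW.exists_vectorTubeFunction W.vacuum n fun j => (⟨k j, α j⟩ : W.Idx)).choose

/-- `wTubeFn` is holomorphic on `𝒯ₙ`. [cite: StreaterWightman1964, Thm 3-5] -/
theorem differentiableOn_wTubeFn (hW : IsSpinorWightmanQFT W) {n : ℕ} (k : Fin n → κ) (α : W.MIdx k) :
    DifferentiableOn ℂ (hW.wTubeFn k α) (forwardTube 3 n) :=
  (hW.exists_vectorTubeFunction W.vacuum n fun j => (⟨k j, α j⟩ : W.Idx)).choose_spec.1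

/-- `wTubeFn` has the boundary value `𝒲_α`. [cite: StreaterWightman1964, Thm 3-5] -/
theorem hasDistributionalBoundaryValue_wTubeFn (hW : IsSpinorWightmanQFT W) {n : ℕ} (k : Fin n → κ)
    (α : W.MIdx k) : HasDistributionalBoundaryValue (hW.wTubeFn k α) (hW.wDist k α) :=
  (hW.exists_vectorTubeFunction W.vacuum n fun j => (⟨k j, α j⟩ : W.Idx)).choose_spec.2

/-- Real translation invariance of `wTubeFn` on `𝒯ₙ`. [cite: StreaterWightman1964, Thm 3-5] -/
theorem wTubeFn_add_real (hW : IsSpinorWightmanQFT W) {n : ℕ} (k : Fin n → κ) (α : W.MIdx k)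
    (a : SpaceTime 3) {z : Fin n → Fin (3 + 1) → ℂ} (hz : z ∈ forwardTube 3 n) :
    hW.wTubeFn k α (fun j => z j + complexifyPoint a) = hW.wTubeFn k α z :=
  eqOn_add_real_of_bv (hW.differentiableOn_wTubeFn k α) (hW.hasDistributionalBoundaryValue_wTubeFn k α)
    (hW.wDist_comp_poincareTestMulti_inl k α) a hz

/-- **The holomorphic Wightman function on the relative tube**, all components at once:
`𝒲(z)_α = wTubeFn_α (z − z₀ + i e₀)` (relativization; Streater–Wightman (1964), Thm. 3-5: "`W` is
a function of the differences"). [cite: StreaterWightman1964, Thm 3-5] -/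
def wRelFn (hW : IsSpinorWightmanQFT W) {n : ℕ} (k : Fin n → κ) (z : Fin n → Fin (3 + 1) → ℂ) : W.MIdx k → ℂ :=
  fun α => relativize (hW.wTubeFn k α) z

/-- Components of `wRelFn`. [folklore] -/
theorem wRelFn_apply (hW : IsSpinorWightmanQFT W) {n : ℕ} (k : Fin n → κ) (z : Fin n → Fin (3 + 1) → ℂ) (α : W.MIdx k) :
    hW.wRelFn k z α = relativize (hW.wTubeFn k α) z := rfl

/-- `wRelFn` is holomorphic on `𝒯ʳₙ` (as a function into the multi-index space). [cite: StreaterWightman1964, Thm 3-5] -/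
theorem differentiableOn_wRelFn (hW : IsSpinorWightmanQFT W) {n : ℕ} (k : Fin n → κ) :
    DifferentiableOn ℂ (hW.wRelFn k) (QuantumFieldTheory.relForwardTube 3 n) :=
  differentiableOn_pi.2 fun α => differentiableOn_relativize (hW.differentiableOn_wTubeFn k α)

/-- Each component of `wRelFn` has the boundary value `𝒲_α`. [cite: StreaterWightman1964, Thm 3-5] -/
theorem hasDistributionalBoundaryValue_wRelFn (hW : IsSpinorWightmanQFT W) {n : ℕ} (k : Fin n → κ) (α : W.MIdx k) :
    HasDistributionalBoundaryValue (fun z => hW.wRelFn k z α) (hW.wDist k α) :=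
  (hW.hasDistributionalBoundaryValue_wTubeFn k α).relativize (hW.differentiableOn_wTubeFn k α)
    (fun a _ hz => hW.wTubeFn_add_real k α a hz)

/-- **`wRelFn` is invariant under all common complex translations.** [cite: StreaterWightman1964, Thm 3-5] -/
theorem wRelFn_add_const (hW : IsSpinorWightmanQFT W) {n : ℕ} (k : Fin n → κ) (z : Fin n → Fin (3 + 1) → ℂ)
    (c : Fin (3 + 1) → ℂ) : hW.wRelFn k (fun j => z j + c) = hW.wRelFn k z := by
  funext α
  exact relativize_add_const _ z c

/-- On `𝒯ₙ` the relativized function is the chosen tube function. [folklore] -/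
theorem wRelFn_apply_eq_wTubeFn (hW : IsSpinorWightmanQFT W) {n : ℕ} (k : Fin n → κ) {z : Fin n → Fin (3 + 1) → ℂ}
    (hz : z ∈ forwardTube 3 n) (α : W.MIdx k) : hW.wRelFn k z α = hW.wTubeFn k α z :=
  relativize_eq_self (hW.differentiableOn_wTubeFn k α) (fun a _ hw => hW.wTubeFn_add_real k α a hw) hz

/-- **Covariance of the holomorphic Wightman function** (Streater–Wightman (1964), Thm. 3-5 with
(3-44)): `𝒲(Λ(A) z)_α = ∑_β ∏ⱼ S_{kⱼ}(A)_{αⱼβⱼ} 𝒲(z)_β` for `A ∈ SL(2, ℂ)` and `z ∈ 𝒯ʳₙ`.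
[cite: StreaterWightman1964, Thm 3-5 eq. (3-44)] -/
theorem wRelFn_lorentz (hW : IsSpinorWightmanQFT W) {n : ℕ} (k : Fin n → κ) (A : SL(2, ℂ))
    {z : Fin n → Fin (3 + 1) → ℂ} (hz : z ∈ QuantumFieldTheory.relForwardTube 3 n) (α : W.MIdx k) :
    hW.wRelFn k (fun j => lorentzActC (spinLorentz A) (z j)) α = ∑ β : W.MIdx k, (∏ j, W.S (k j) A (α j) (β j)) * hW.wRelFn k z β := by
  have h := apply_lorentz_eq_sum_of_bv (F := hW.wRelFn k) (hW.differentiableOn_wRelFn k)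
    (hW.hasDistributionalBoundaryValue_wRelFn k) (spinCoverHom A)
    (fun α β => ∏ j, W.S (k j) A (α j) (β j)) (fun α => hW.wDist_comp_poincareTestMulti_inr k α A) hz α
  exact h

end IsSpinorWightmanQFT

end Literature.Analysis.FunctionSpaces
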